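import Summits.NavierStokesRegularity.NavierStokesRegularity.Theses.ExtremiserTransience
import Summits.NavierStokesRegularity.NavierStokesRegularity.Theorems.ExtremiserTransienceBangBangCoreDefs
import Summits.NavierStokesRegularity.NavierStokesRegularity.Theorems.ExtremiserTransienceZoneTransversalityDefs
import Summits.NavierStokesRegularity.NavierStokesRegularity.Theorems.ExtremiserTransiencePlateauSobolevCost
import Summits.NavierStokesRegularity.NavierStokesRegularity.Theorems.ExtremiserTransienceRegularisedNearPlateauStabilitySparseNearPlateauStability
import Summits.NavierStokesRegularity.NavierStokesRegularity.Theorems.ExtremiserTransienceAnalyticGapOfPlateauSpread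
import Summits.NavierStokesRegularity.NavierStokesRegularity.Theorems.ExtremiserTransienceAnalyticPlateauSpread
import HarnessLib

/-!
# LINE g8-β «analytic gap» — crux `NearExtremalTransiencePerFlow` (stmt-NavierStokesRegularity-26567)

Route `ExtremiserTransience` (sub-problem = summit `NavierStokesRegularity`).  Ideator seat `ns-idea-5`, generation g8,
technique card «extremal-example mining».  A crux WORKFILE (`Cruxes/NearExtremalTransiencePerFlow/Lines/analytic_gap.lean`),
not a registered skeleton: no registry verb is run on items 26567 / 28317 (KEY-NS #155 (1)); β `Lines/zone_transversality.lean`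
stays the skeleton of record.  **No summit is proved by a line.**  Navier–Stokes regularity is NOT proved by anything here.

## The idea in one paragraph

The tree already knows the QUALITATIVE fact behind the whole `ExtremiserTransience` programme:
`DepletionLadder.slice_lt_sharp` — on every positive-time slice of a classical Leray–Hopf flow the depletion inequality is
STRICT, `|J| < κ⋆·M·√Z·√P`, because the slice is real-analytic (`tautLoopAnal_slice_and_curl`) and real-analytic admissible
fields never attain `κ⋆` (`KStar.not_attained_of_analyticOnNhd`: an attainer carries a speed plateau `|v| ≡ M` on an open
set — `KStarAttainedContact`).  What the crux needs and the tree lacks is a UNIFORM version: a deficit `ε > 0` depending only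
on flow-uniform data.  This line supplies it on the SPARSE class by QUANTIFYING both halves of that argument:

* «plateau»  ⟶  LINE g8-α's bang-bang near-plateau stability S-B (`SparseNearPlateauStability`, shared verbatim): a
  `(κ⋆−ε)`-efficient, `A`-regular, sparse field has a `δ`-near-top set filling a fixed fraction `c₀` of a ball `B(x₀, rλ)`,
  with `c₀, r` free of `δ`;
* «analytic»  ⟶  QUANTITATIVE ANALYTICITY at the dissipation scale, `‖Dʲv‖_∞ ≤ j!·ρ^{-j}·M·λ^{-j}` (`IsAnalyticReg ρ`),
  which every Type-I slice enjoys with a flow-uniform `ρ` (Grujić–Kukavica 1998), and the REMEZ-TYPE INEQUALITY FOR ANALYTIC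
  FUNCTIONS (Brudnyi 1999): if the analytic function `g = M² − |v|²` (`0 ≤ g ≤ M²`, complexified on the `ρλ/2`-tube) is
  `≤ 2δM²` on a set of volume fraction `c₀` of `B(x₀,rλ)`, then `g ≤ C·δ^θ·M²` on the whole of `B(x₀,Rλ)` for any fixed `R`
  (`θ, C` depend on `ρ, r, c₀, R` only) — the near-plateau SPREADS to a full ball of any prescribed radius;
* «`L²` forbids plateaus»  ⟶  a SOBOLEV COST: `|v| ≥ M/2` on `B(x₀, Rλ)` for an `L²` divergence-free field forces
  `Z = ‖∇v‖₂² ≥ c·R·λ·M²` (Gagliardo–Nirenberg–Sobolev on a truncation of `|v|²/M²`), i.e. cell number `N = Wλ/M² ≥ c·R`,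
  contradicting sparseness `N ≤ N₀` once `R > N₀/c`.

Hence (G, PROVED below from the three pieces): **sparse analytic gap** — for every `ρ ∈ (0,1]` and `N₀` there is `ε(ρ,N₀) > 0`
such that every admissible, `ρ`-analytic-regular, `N₀`-sparse field has `|J| ≤ (κ⋆ − ε)·M·√Z·√W`.  On the flow side a violator
has (S-E, the shared OPEN HEART of g8-α: sparse near-efficient locked late times for every deficit) slices in exactly this
class with deficit `→ 0` (S-A, provable-grade transfer: Type-I analyticity radius + the two locks + the Leray lower rate) —
contradiction.  The line never builds the zoom / ancient Oseen-mild object of g8-α's S-T and never calls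
`plateauSliceRigidity`: unique continuation is replaced by its static analytic shadow (Remez), applied to each slice separately
(no limits, hence no Galilean-boost / infinite-energy limit objects).

## Skeleton: six stubs (rev 3: P-R split into the Literature FACT P-F + bookkeeping), one proved reduction, one kernel-checked composition

* S-B `stub_sparseNearPlateauStability : SparseNearPlateauStability` — verbatim LINE g8-α (shared; one proof closes both).
* P-F `stub_propagationOfSmallness : AnalyticPropagationOfSmallness` — LITERATURE FACT (Vessella 1999 / AEWZ 2014 Thm 4),
  typed here as a Prop for a typer to lift into `Literature/`; never proved in the tree, consumed as a named hypothesis.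
* P-R `stub_analyticPlateauSpread : AnalyticPropagationOfSmallness → AnalyticPlateauSpread` — two applications of P-F to
  `M² − |v|²` with Leibniz bounds from `IsAnalyticReg` (M, bookkeeping).
* P-C `stub_plateauSobolevCost : PlateauSobolevCost` — **LANDED** (rev 4): prover ns-net-p1 g2, p672703
  `Theorems/ExtremiserTransiencePlateauSobolevCost.lean` (`…Theorems.NearExtremalTransiencePerFlow.AnalyticGap.plateauSobolevCost`,
  statement verbatim, whole-space Sobolev `L⁶` + `‖Dv‖₂ ≤ ‖curl v‖₂`); the stub below is now CLOSED by that theorem (no `sorry`).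
* S-A `stub_sparseAnalyticTransfer : SparseAnalyticTransfer` — flow side, provable-grade.
* S-E `stub_sparseEfficientTimes : SparseEfficientTimes` — verbatim LINE g8-α (OPEN HEART: the crowd wall).
* `sparseAnalyticGap_of : S-B → P-R → P-C → SparseAnalyticGap` — PROVED here (constant bookkeeping).
* `NearExtremalTransiencePerFlow_of : S-B → P-F → P-R → P-C → S-A → S-E → NearExtremalTransiencePerFlow` — PROVED here.

Names used verbatim: `IsViolator` (Theorems/…ZoneTransversalityDefs), `BangBang.{IsAdm, IsReg, lam}` (…BangBangCoreDefs),
`HalfSpace.{E3, kStar, Jst, Zen, Wpa}`.  [folklore]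
-/

noncomputable section

open scoped Topology InnerProductSpace RealInnerProductSpace ENNReal ContDiff
open MeasureTheory Filter Set Metric
open Literature.Analysis.FluidPDE
open Summit.NavierStokesRegularity.NavierStokesRegularity.Theses.ExtremiserTransience
open Summit.NavierStokesRegularity.NavierStokesRegularity.Theorems.DepletionLadder.KStar
open Summit.NavierStokesRegularity.NavierStokesRegularity.Theorems.DepletionLadder.KStar.HalfSpace
open Summit.NavierStokesRegularity.NavierStokesRegularity.Theorems.DepletionLadder.KStar.BangBang
open Summit.NavierStokesRegularity.NavierStokesRegularity.Theorems.NearExtremalTransiencePerFlow.ZoneTransversality (PFC IsViolator)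

namespace Summit.NavierStokesRegularity.NavierStokesRegularity.Cruxes.NearExtremalTransiencePerFlow.AnalyticGap

set_option linter.dupNamespace false
set_option linter.unusedVariables false

/-! ## §0 Vocabulary -/

/-- SPARSE at cell number `N₀` (verbatim LINE g8-α `SparseBangBang.IsSparse`): `W·λ ≤ N₀·M²`, i.e. the field carries at
most `N₀` cells of enstrophy `M²λ` (`N := Wλ/M² = Z/(λM²)`, `λ = √(Z/W)`). -/
def IsSparse (N₀ : ℝ) (v : E3 → E3) (M : ℝ) : Prop := Wpa v * lam v ≤ N₀ * M ^ 2

/-- QUANTITATIVE ANALYTICITY AT THE DISSIPATION SCALE with radius parameter `ρ`: `‖Dʲv‖_∞ ≤ (j!·ρ^{-j})·M·λ^{-j}` for every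
`j` — the Cauchy-estimate form of "real-analytic with radius `ρ·λ(v)` and complex-strip bound `∼ M`".  Written in the shape
of `BangBang.IsReg` so that `IsAnalyticReg ρ v M` IS `IsReg (fun j ↦ j!·ρ^{-j}) v M` definitionally.  (With `ContDiff ℝ ⊤ v`,
part of `IsAdm`, the `iteratedFDeriv` are the true derivatives; without it the predicate would be junk-vacuous.) -/
def IsAnalyticReg (ρ : ℝ) (v : E3 → E3) (M : ℝ) : Prop :=
  ∀ (j : ℕ) (x : E3), ‖iteratedFDeriv ℝ j v x‖ ≤ ((j.factorial : ℝ) * ρ⁻¹ ^ j) * M * (lam v)⁻¹ ^ j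

/-- The regularity budget of a `ρ`-analytic-regular field. -/
def facBudget (ρ : ℝ) : ℕ → ℝ := fun j => (j.factorial : ℝ) * ρ⁻¹ ^ j

theorem isReg_of_isAnalyticReg {ρ : ℝ} {v : E3 → E3} {M : ℝ} (h : IsAnalyticReg ρ v M) :
    IsReg (facBudget ρ) v M := fun j x => h j x

theorem one_le_facBudget {ρ : ℝ} (hρ : 0 < ρ) (hρ1 : ρ ≤ 1) (j : ℕ) : 1 ≤ facBudget ρ j := by
  have h1 : (1 : ℝ) ≤ (j.factorial : ℝ) := by exact_mod_cast Nat.succ_le_of_lt (Nat.factorial_pos j)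
  have h2 : (1 : ℝ) ≤ ρ⁻¹ ^ j := one_le_pow₀ ((one_le_inv₀ hρ).2 hρ1)
  simpa [facBudget] using one_le_mul_of_one_le_of_one_le h1 h2

/-! ## §1 The statements -/

/-- (S-B — verbatim LINE g8-α, PROVABLE, shared) SPARSE NEAR-PLATEAU STABILITY: for every regularity budget `A` and cell bound
`N₀` there are `c₀, r > 0` such that for every `δ > 0` some `ε > 0` works: an admissible, `A`-regular, `N₀`-sparse,
non-degenerate, `(κ⋆−ε)`-efficient field has a ball `B(x₀, r·λ)` at least `c₀`-filled by `{‖v‖ ≥ (1−δ)M}`. -/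
def SparseNearPlateauStability : Prop :=
  ∀ A : ℕ → ℝ, (∀ j, 1 ≤ A j) → ∀ N₀ : ℝ, 0 < N₀ → ∃ c₀ r : ℝ, 0 < c₀ ∧ 0 < r ∧ ∀ δ : ℝ, 0 < δ → ∃ ε : ℝ, 0 < ε ∧
    ∀ (v : E3 → E3) (M B : ℝ), IsAdm v M B → IsReg A v M → IsSparse N₀ v M →
      0 < M * Real.sqrt (Zen v) * Real.sqrt (Wpa v) →
      (kStar - ε) * M * Real.sqrt (Zen v) * Real.sqrt (Wpa v) ≤ |Jst v| →
        ∃ x₀ : E3, ENNReal.ofReal (c₀ * (r * lam v) ^ 3) ≤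
          volume {x : E3 | x ∈ Metric.ball x₀ (r * lam v) ∧ (1 - δ) * M ≤ ‖v x‖}

/-- (P-F, LITERATURE FACT — to be typed as ONE Literature decl and cited, not proved here; rev 3) PROPAGATION OF
SMALLNESS FOR REAL-ANALYTIC FUNCTIONS FROM MEASURABLE SETS, in `E3`, operator-norm form: Vessella, Forum Math. 11 (1999)
695–703; Apraiz–Escauriaza–Wang–Zhang, JEMS 16 (2014) Thm 4 [arXiv:1202.4876 p5]: for `0 < ρ ≤ 1` and a volume fraction
`0 < s ≤ 1` there are `N > 0`, `θ ∈ (0,1]` such that every smooth `f` on `B(x₀,2R)` with `‖Dʲf‖ ≤ M·j!/(ρR)ʲ` there (hence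
real-analytic) and every measurable `E ⊆ B(x₀,R)` with `|E| ≥ s|B(x₀,R)|` satisfy `sup_{B(x₀,R)} |f| ≤ N (⨍_E |f|)^θ M^{1−θ}`.
(Operator-norm bounds on `iteratedFDeriv` imply the paper's partial-derivative bounds with the same `M, ρ`.  The `|E| ≥ s|B_R|`
form needs NO monotonicity of the constants in the fraction (which the paper does not state; idea-crit-4 read-back (iii)):
given `E` with `|E| ≥ s|B_R|`, Lebesgue measure is atomless, so there is a sub-level portion `E' ⊆ E` with `|E'| = s|B_R|`
exactly (`E' = E ∩ {|f| < τ}` plus a measurable part of the level set); then `⨍_{E'}|f| ≤ ⨍_E|f|` and Thm 4 at fraction `s`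
gives `sup_{B_R}|f| ≤ N(ρ,s)(⨍_{E'}|f|)^θ M^{1−θ} ≤ N(ρ,s)(⨍_E|f|)^θ M^{1−θ}`.  `θ ≤ 1` instead of `< 1` is harmless ∃-slack.) -/
def AnalyticPropagationOfSmallness : Prop :=
  ∀ ρ s : ℝ, 0 < ρ → ρ ≤ 1 → 0 < s → s ≤ 1 →
    ∃ Nc θ : ℝ, 0 < Nc ∧ 0 < θ ∧ θ ≤ 1 ∧
      ∀ (f : E3 → ℝ) (x₀ : E3) (R M : ℝ), 0 < R → 0 < M → ContDiff ℝ (⊤ : ℕ∞) f →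
        (∀ (j : ℕ) (x : E3), x ∈ Metric.ball x₀ (2 * R) →
            ‖iteratedFDeriv ℝ j f x‖ ≤ M * (j.factorial : ℝ) / (ρ * R) ^ j) →
        ∀ E : Set E3, MeasurableSet E → E ⊆ Metric.ball x₀ R →
          s * (volume (Metric.ball x₀ R)).toReal ≤ (volume E).toReal →
          ∀ x ∈ Metric.ball x₀ R,
            |f x| ≤ Nc * ((∫ y in E, |f y|) / (volume E).toReal) ^ θ * M ^ (1 - θ)

/-- (P-R, Literature-grade) ANALYTIC PLATEAU SPREAD — the Remez-type inequality for analytic functions applied to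
`g = M² − |v|²`: for `ρ, r, c₀, R, η > 0` there is `δ > 0` such that a smooth field bounded by `M > 0`, `ρ`-analytic-regular,
whose `δ`-near-top set fills a `c₀`-fraction of `B(x₀, rλ)`, satisfies `‖v‖ ≥ (1−η)M` on ALL of `B(x₀, Rλ)`.
IN PRINT in Hölder form with exactly the `IsAnalyticReg` hypothesis (rev 2, idea-crit-4 g6 N1): Apraiz–Escauriaza–Wang–Zhang,
JEMS 16 (2014) Thm 4 [arXiv:1202.4876 p5], first proved by Vessella, Forum Math. 11 (1999) 695–703 — «`f` real-analytic in `B_{2R}`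
with `|∂^α f| ≤ M|α|!(ρR)^{-|α|}`, `0 < ρ ≤ 1`, `E ⊂ B_R` of positive measure ⇒ `‖f‖_{L^∞(B_R)} ≤ N (⨍_E |f|)^θ M^{1-θ}`,
`N, θ` depending only on `(ρ, |E|/|B_R|)`». Two applications to `g = M² − |v|²` (Leibniz: `|∂^α g| ≤ 3M²·|α|!·(ρλ/2)^{-|α|}`):
on `B(x₀, rλ)` from the near-top set (`⨍_E g ≤ 2δM²`), then on `B(x₀, Rλ)` from `E = B(x₀, rλ)`; both constants fixed
before `δ`. (Earlier route via Brudnyi's Remez-type inequality with the Bernstein index is not needed.)) -/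
def AnalyticPlateauSpread : Prop :=
  ∀ ρ r c₀ R η : ℝ, 0 < ρ → 0 < r → 0 < c₀ → 0 < R → 0 < η → ∃ δ : ℝ, 0 < δ ∧
    ∀ (v : E3 → E3) (M : ℝ) (x₀ : E3), 0 < M → ContDiff ℝ (⊤ : ℕ∞) v → (∀ x, ‖v x‖ ≤ M) →
      IsAnalyticReg ρ v M → 0 < lam v →
      ENNReal.ofReal (c₀ * (r * lam v) ^ 3) ≤ volume {x : E3 | x ∈ Metric.ball x₀ (r * lam v) ∧ (1 - δ) * M ≤ ‖v x‖} →
        ∀ x ∈ Metric.ball x₀ (R * lam v), (1 - η) * M ≤ ‖v x‖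

/-- (P-C, M) PLATEAU SOBOLEV COST — `L²` fields cannot afford large half-plateaus cheaply: there is an absolute `c > 0` with
`c·R·λ·M² ≤ Z` whenever an admissible field has `‖v‖ ≥ M/2` on a ball `B(x₀, R·λ)`.  (GNS `‖w‖₆ ≤ C_S‖∇w‖₂` for a smooth
truncation `w = f(|v|²/M²)`, `w = 1` on the ball, `|∇w| ≤ 11|∇v|/M`, `∫|∇v|² = Z` for divergence-free `H¹` fields, and
`w ∈ L²` from `v ∈ L²` for the compact-support approximation.) -/
def PlateauSobolevCost : Prop :=
  ∃ c : ℝ, 0 < c ∧ ∀ (v : E3 → E3) (M B R : ℝ) (x₀ : E3), IsAdm v M B → 0 < M → 0 < R → 0 < lam v →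
    (∀ x ∈ Metric.ball x₀ (R * lam v), M / 2 ≤ ‖v x‖) → c * (R * lam v) * M ^ 2 ≤ Zen v

/-- (G — PROVED below from S-B, P-R, P-C) SPARSE ANALYTIC GAP, the uniform form of `DepletionLadder.slice_lt_sharp` on the
sparse class: for `ρ ∈ (0,1]` and `N₀ > 0` there is `ε > 0` with `|J| ≤ (κ⋆ − ε)·M·√Z·√W` for every admissible,
`ρ`-analytic-regular, `N₀`-sparse, non-degenerate field. -/
def SparseAnalyticGap : Prop :=
  ∀ ρ : ℝ, 0 < ρ → ρ ≤ 1 → ∀ N₀ : ℝ, 0 < N₀ → ∃ ε : ℝ, 0 < ε ∧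
    ∀ (v : E3 → E3) (M B : ℝ), IsAdm v M B → IsAnalyticReg ρ v M → IsSparse N₀ v M →
      0 < M * Real.sqrt (Zen v) * Real.sqrt (Wpa v) →
        |Jst v| ≤ (kStar - ε) * M * Real.sqrt (Zen v) * Real.sqrt (Wpa v)

/-- (S-E — verbatim LINE g8-α, OPEN HEART, shared) SPARSE EFFICIENT TIMES. -/
def SparseEfficientTimes : Prop :=
  ∀ (C ν T : ℝ) (u : ℝ → E3 → E3) (p : ℝ → E3 → ℝ), IsViolator C ν T u p →
    ∃ N₀ Θ : ℝ, ∀ ε : ℝ, 0 < ε → ∀ t₁ ∈ Set.Ico 0 T, ∃ t ∈ Set.Ico t₁ T,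
      Zen (u t) * Real.sqrt (T - t) ≤ N₀ * (ν * Real.sqrt ν) ∧
      Θ⁻¹ * (ν * (T - t)) * Wpa (u t) ≤ Zen (u t) ∧ Zen (u t) ≤ Θ * (ν * (T - t)) * Wpa (u t) ∧
      ∃ M : ℝ, (∀ x, ‖u t x‖ ≤ M) ∧ 0 < M * Real.sqrt (Zen (u t)) * Real.sqrt (Wpa (u t)) ∧
        (kStar - ε) * M * Real.sqrt (Zen (u t)) * Real.sqrt (Wpa (u t)) ≤ |Jst (u t)|

/-- (S-A, provable-grade) SPARSE ANALYTIC TRANSFER — the flow side: given S-E, a violator flow has flow-uniform `ρ ∈ (0,1]`,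
`N₀ > 0` such that for every `ε > 0` some slice `u(t)`, `t ∈ [0,T)`, with some bounds `M, B`, is admissible,
`ρ`-analytic-regular, `N₀`-sparse, non-degenerate and `(κ⋆−ε)`-efficient.  (From S-E's sparse two-sided-locked near-efficient
late time: `IsAdm` by classical smoothness + slice Sobolev finiteness; analyticity radius `≥ c·√(ν(T−t))/C'` with strip bound
`≤ 2C√ν/√(T−t')` by Grujić–Kukavica 1998 (Thm 2.1/3.6) restarted at `t' = t − (T−t)/C'²`, converted to `λ(u t)` by the upper
lock and to the height `M ≥ ‖u(t)‖_∞ ≥ c₀√ν/√(T−t)` by `PerFlow.lerayLowerRate_of_not_extends`; sparseness in `λ(u t)` units by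
the lower lock.) -/
def SparseAnalyticTransfer : Prop :=
  SparseEfficientTimes → ∀ (C ν T : ℝ) (u : ℝ → E3 → E3) (p : ℝ → E3 → ℝ), IsViolator C ν T u p →
    ∃ ρ N₀ : ℝ, 0 < ρ ∧ ρ ≤ 1 ∧ 0 < N₀ ∧ ∀ ε : ℝ, 0 < ε → ∃ (t M B : ℝ), t ∈ Set.Ico 0 T ∧
      IsAdm (u t) M B ∧ IsAnalyticReg ρ (u t) M ∧ IsSparse N₀ (u t) M ∧
      0 < M * Real.sqrt (Zen (u t)) * Real.sqrt (Wpa (u t)) ∧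
      (kStar - ε) * M * Real.sqrt (Zen (u t)) * Real.sqrt (Wpa (u t)) ≤ |Jst (u t)|

/-! ## §2 The reduction G ⇐ S-B + P-R + P-C (PROVED) -/

/-- Positivity unpacking of the non-degeneracy hypothesis `0 < M·√Z·√W`. -/
theorem pos_unpack {v : E3 → E3} {M : ℝ} (hpos : 0 < M * Real.sqrt (Zen v) * Real.sqrt (Wpa v)) :
    0 < M ∧ 0 < Zen v ∧ 0 < Wpa v ∧ 0 < lam v := by
  have hW' : 0 < Real.sqrt (Wpa v) := by
    rcases (Real.sqrt_nonneg (Wpa v)).eq_or_lt with h | h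
    · rw [← h, mul_zero] at hpos; exact absurd hpos (lt_irrefl 0)
    · exact h
  have h1 : 0 < M * Real.sqrt (Zen v) := (mul_pos_iff_of_pos_right hW').1 hpos
  have hZ' : 0 < Real.sqrt (Zen v) := by
    rcases (Real.sqrt_nonneg (Zen v)).eq_or_lt with h | h
    · rw [← h, mul_zero] at h1; exact absurd h1 (lt_irrefl 0)
    · exact h
  have hM : 0 < M := (mul_pos_iff_of_pos_right hZ').1 h1
  have hZ : 0 < Zen v := Real.sqrt_pos.1 hZ'
  have hW : 0 < Wpa v := Real.sqrt_pos.1 hW'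
  refine ⟨hM, hZ, hW, ?_⟩
  unfold lam
  exact Real.sqrt_pos.2 (div_pos hZ hW)

/-- `Z = λ²·W` for a non-degenerate field. -/
theorem zen_eq_lam_sq_mul {v : E3 → E3} (hZ : 0 < Zen v) (hW : 0 < Wpa v) : Zen v = lam v ^ 2 * Wpa v := by
  unfold lam
  rw [Real.sq_sqrt (div_nonneg hZ.le hW.le)]
  field_simp

/-- **G from S-B, P-R, P-C.**  Given `ρ ∈ (0,1]`, `N₀`: take `A = (j ↦ j!ρ^{-j})`, `(c₀,r)` from S-B, `R = (N₀+1)/c` from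
P-C's constant, `δ` from P-R at `η = 1/2`, `ε` from S-B at `δ`.  A field in the class with deficit `< ε` would have a
`c₀`-filled ball (S-B), hence `‖v‖ ≥ M/2` on `B(x₀,Rλ)` (P-R), hence `c·R·λ·M² ≤ Z = λ·(Wλ) ≤ λ·N₀M²` (P-C, sparseness),
i.e. `N₀ + 1 = cR ≤ N₀`. -/
theorem sparseAnalyticGap_of (hB : SparseNearPlateauStability) (hR : AnalyticPlateauSpread)
    (hC : PlateauSobolevCost) : SparseAnalyticGap := by
  intro ρ hρ hρ1 N₀ hN₀
  obtain ⟨c, hc, hcost⟩ := hC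
  obtain ⟨c₀, r, hc₀, hr, hδ⟩ := hB (facBudget ρ) (one_le_facBudget hρ hρ1) N₀ hN₀
  set R : ℝ := (N₀ + 1) / c with hRdef
  have hRpos : 0 < R := div_pos (by linarith) hc
  have hcR : c * R = N₀ + 1 := by rw [hRdef]; field_simp
  obtain ⟨δ, hδpos, hspread⟩ := hR ρ r c₀ R (1 / 2) hρ hr hc₀ hRpos (by norm_num)
  obtain ⟨ε, hε, hfat⟩ := hδ δ hδpos
  refine ⟨ε, hε, ?_⟩
  intro v M B hadm han hsp hpos
  by_contra hlt
  push Not at hlt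
  obtain ⟨hM, hZ, hW, hlam⟩ := pos_unpack hpos
  obtain ⟨x₀, hvol⟩ := hfat v M B hadm (isReg_of_isAnalyticReg han) hsp hpos hlt.le
  have hplateau := hspread v M x₀ hM hadm.1 hadm.2.2.1 han hlam hvol
  have hcostv : c * (R * lam v) * M ^ 2 ≤ Zen v :=
    hcost v M B R x₀ hadm hM hRpos hlam (fun x hx => by have := hplateau x hx; linarith)
  have hZeq := zen_eq_lam_sq_mul hZ hW
  have h2 : lam v * (c * R * M ^ 2) ≤ lam v * (N₀ * M ^ 2) := by
    have h3 : Zen v ≤ lam v * (N₀ * M ^ 2) := by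
      calc Zen v = lam v * (Wpa v * lam v) := by rw [hZeq]; ring
        _ ≤ lam v * (N₀ * M ^ 2) := mul_le_mul_of_nonneg_left hsp hlam.le
    have h4 : lam v * (c * R * M ^ 2) = c * (R * lam v) * M ^ 2 := by ring
    linarith [hcostv, h3, h4]
  have key : c * R * M ^ 2 ≤ N₀ * M ^ 2 := le_of_mul_le_mul_left h2 hlam
  rw [hcR] at key
  nlinarith [hM, key]

/-! ## §3 Stubs (the ONLY `sorry`s of the file — two after rev 7: P-F (a Literature NAMED FACT, now typed as `Literature.Analysis.PDE.analyticPropagationOfSmallness 3`, used as a hypothesis below) and S-E (the open heart); P-C, S-B, P-R, S-A are closed by landed theorems) and registration names -/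

/-- S-B — **PROVED** (rev 6, 2026-08-28): closed by the LANDED theorem `…KStar.BangBang.sparseNearPlateauStability`
(p673874, prover seat ns-net-p2 g2; statement verbatim with `IsSparse` unfolded — the kernel confirms the match here; one
proof closes the shared stub of LINE g8-α and of this line).  No `sorry`. -/
theorem stub_sparseNearPlateauStability : SparseNearPlateauStability :=
  Summit.NavierStokesRegularity.NavierStokesRegularity.Theorems.DepletionLadder.KStar.BangBang.sparseNearPlateauStability

/-- P-F (LITERATURE FACT, Vessella 1999 / AEWZ 2014 Thm 4 — lands by typing + citing under `Literature/`, after which this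
stub is discharged by `exact thatDecl`-style glue or kept as a named-fact hypothesis of the line). -/
theorem stub_propagationOfSmallness : AnalyticPropagationOfSmallness := by
  sorry

/-- P-R (M, bookkeeping over the fact): two applications of P-F to `g = M² − Σᵢ vᵢ²` (Leibniz bounds
`‖Dʲg‖ ≤ 3M²·2ʲ·j!·(ρλ)^{-j}` from `IsAnalyticReg`; first ball `B(x₀,rλ)` with `E` = the near-top set, then `B(x₀,Rλ)` with
`E = B(x₀,rλ)`; constants fixed before `δ`). -/
theorem stub_analyticPlateauSpread : AnalyticPropagationOfSmallness → AnalyticPlateauSpread :=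
  -- P-R — **PROVED** (rev 7, 2026-08-28): landed `…Theorems.NearExtremalTransiencePerFlow.AnalyticGap.analyticPlateauSpread_of_propagation`
  -- (p674832, prover seat ns-net-p1 g2, over the texts of record `Theorems/ExtremiserTransienceAnalyticGapDefs.lean` p673336); kernel match.
  Summit.NavierStokesRegularity.NavierStokesRegularity.Theorems.NearExtremalTransiencePerFlow.AnalyticGap.analyticPlateauSpread_of_propagation

/-- P-C — **CLOSED** (rev 4) by the landed `Theorems.NearExtremalTransiencePerFlow.AnalyticGap.plateauSobolevCost` (p672703,
statement verbatim; definitional unfolding). Kept under its registered name so the stub set is unchanged. -/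
theorem stub_plateauSobolevCost : PlateauSobolevCost :=
  Summit.NavierStokesRegularity.NavierStokesRegularity.Theorems.NearExtremalTransiencePerFlow.AnalyticGap.plateauSobolevCost

/-- S-A (provable-grade): sparse analytic transfer on the flow side. -/
theorem stub_sparseAnalyticTransfer : SparseAnalyticTransfer :=
  -- S-A — **PROVED** (rev 7, 2026-08-28): landed `…Theorems.NearExtremalTransiencePerFlow.AnalyticGap.sparseAnalyticTransfer` (p674280,
  -- prover seat ns-net-p1 g2; NO new fact: Guberović/Grujić analytic restarts + `Literature/Analysis/FluidPDE/TubeSliceCauchyEstimates.lean`).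
  Summit.NavierStokesRegularity.NavierStokesRegularity.Theorems.NearExtremalTransiencePerFlow.AnalyticGap.sparseAnalyticTransfer

/-- S-E (OPEN HEART, shared with LINE g8-α): sparse efficient times. -/
theorem stub_sparseEfficientTimes : SparseEfficientTimes := by
  sorry

namespace Registered
/-- registered name of S-B -/
abbrev stub_sparseNearPlateauStability : Prop := SparseNearPlateauStability
/-- registered name of P-F (Literature fact) -/
abbrev stub_propagationOfSmallness : Prop := AnalyticPropagationOfSmallness
/-- registered name of P-R -/
abbrev stub_analyticPlateauSpread : Prop := AnalyticPropagationOfSmallness → AnalyticPlateauSpread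
/-- registered name of P-C -/
abbrev stub_plateauSobolevCost : Prop := PlateauSobolevCost
/-- registered name of S-A -/
abbrev stub_sparseAnalyticTransfer : Prop := SparseAnalyticTransfer
/-- registered name of S-E -/
abbrev stub_sparseEfficientTimes : Prop := SparseEfficientTimes
end Registered

/-! ## §4 Composition (kernel-checked, no `sorry`): S-B → P-F → P-R → P-C → S-A → S-E → the crux BY NAME -/

/-- **The line decides the crux.**  Contrapositively: a violator flow has (S-A fed by S-E) flow-uniform `ρ, N₀` and, for the
gap `ε(ρ,N₀)` of G (= S-B + P-R + P-C), a slice in the sparse `ρ`-analytic class with deficit `ε/2 < ε` — absurd. -/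
theorem NearExtremalTransiencePerFlow_of (hB : Registered.stub_sparseNearPlateauStability)
    (hF : Registered.stub_propagationOfSmallness) (hR : Registered.stub_analyticPlateauSpread)
    (hPC : Registered.stub_plateauSobolevCost)
    (hA : Registered.stub_sparseAnalyticTransfer) (hE : Registered.stub_sparseEfficientTimes) :
    Summit.NavierStokesRegularity.NavierStokesRegularity.Theses.ExtremiserTransience.NearExtremalTransiencePerFlow := by
  intro C ν T hC hν hT0 u p hsol hLH hdec hrate hne
  by_contra hno
  obtain ⟨ρ, N₀, hρ, hρ1, hN₀, hall⟩ := hA hE C ν T u p ⟨hC, hν, hT0, hsol, hLH, hdec, hrate, hne, hno⟩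
  obtain ⟨ε, hε, hgap⟩ := sparseAnalyticGap_of hB (hR hF) hPC ρ hρ hρ1 N₀ hN₀
  obtain ⟨t, M, B, ht, hadm, han, hsp, hpos, heff⟩ := hall (ε / 2) (half_pos hε)
  have h := hgap (u t) M B hadm han hsp hpos
  nlinarith [mul_pos hε hpos, heff, h]

/-- Five-hypothesis form after the landing of P-C (rev 4): S-B → P-F → P-R → S-A → S-E → the crux. -/
theorem NearExtremalTransiencePerFlow_of₅ (hB : Registered.stub_sparseNearPlateauStability)
    (hF : Registered.stub_propagationOfSmallness) (hR : Registered.stub_analyticPlateauSpread)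
    (hA : Registered.stub_sparseAnalyticTransfer) (hE : Registered.stub_sparseEfficientTimes) :
    Summit.NavierStokesRegularity.NavierStokesRegularity.Theses.ExtremiserTransience.NearExtremalTransiencePerFlow :=
  NearExtremalTransiencePerFlow_of hB hF hR stub_plateauSobolevCost hA hE

/-- Four-hypothesis form after the landing of S-B (rev 6): P-F → P-R → S-A → S-E → the crux.  P-F is a literature fact
(Vessella 1999 / AEWZ 2014 Thm 4) awaiting typing under `Literature/`; the mathematical residual is P-R ∧ S-A ∧ S-E. -/
theorem NearExtremalTransiencePerFlow_of₄ (hF : Registered.stub_propagationOfSmallness)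
    (hR : Registered.stub_analyticPlateauSpread) (hA : Registered.stub_sparseAnalyticTransfer)
    (hE : Registered.stub_sparseEfficientTimes) :
    Summit.NavierStokesRegularity.NavierStokesRegularity.Theses.ExtremiserTransience.NearExtremalTransiencePerFlow :=
  NearExtremalTransiencePerFlow_of₅ stub_sparseNearPlateauStability hF hR hA hE

/-- **RESIDUAL = NAMED FACT + OPEN HEART (rev 7).**  `Literature.Analysis.PDE.analyticPropagationOfSmallness 3 → SparseEfficientTimes →
NearExtremalTransiencePerFlow`: P-F enters as the tree's named Literature fact (AEWZ 2014 Thm 4 / Vessella 1999, typed by ns-net-p1,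
`Literature/Analysis/PDE/AnalyticPropagationOfSmallness.lean`), converted to this file's `AnalyticPropagationOfSmallness` definitionally;
P-C, S-B, P-R, S-A are landed theorems.  (Theorems copy: `…AnalyticGap.nearExtremalTransiencePerFlow_of_fact`.) -/
theorem NearExtremalTransiencePerFlow_of_fact (hF : Literature.Analysis.PDE.analyticPropagationOfSmallness 3)
    (hE : Registered.stub_sparseEfficientTimes) :
    Summit.NavierStokesRegularity.NavierStokesRegularity.Theses.ExtremiserTransience.NearExtremalTransiencePerFlow :=
  NearExtremalTransiencePerFlow_of₄
    (Summit.NavierStokesRegularity.NavierStokesRegularity.Theorems.NearExtremalTransiencePerFlow.AnalyticGap.analyticPropagationOfSmallness_of_literature hF)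
    stub_analyticPlateauSpread stub_sparseAnalyticTransfer hE

/-- How the closed proof is obtained once the remaining stubs land. -/
example : Summit.NavierStokesRegularity.NavierStokesRegularity.Theses.ExtremiserTransience.NearExtremalTransiencePerFlow :=
  NearExtremalTransiencePerFlow_of stub_sparseNearPlateauStability stub_propagationOfSmallness stub_analyticPlateauSpread
    stub_plateauSobolevCost stub_sparseAnalyticTransfer stub_sparseEfficientTimes

end Summit.NavierStokesRegularity.NavierStokesRegularity.Cruxes.NearExtremalTransiencePerFlow.AnalyticGap

end
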